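import Summits.QuantumFields.YangMills.Theorems.ColdStartUniversalityLatticeLangevinLiebRobinsonPlaquetteSmallCoupling
import HarnessLib

/-!
# Route `ColdStartUniversality` (fixed-cut-off SZZ dynamics; LIEB–ROBINSON / LOCALITY package, file 27):
# ★★ EVERY WILSON LOOP THROUGH SOME LINK AN ODD NUMBER OF TIMES IS `O(β')` UNIFORMLY IN THE VOLUME

Helper file (seat `ym-line-csu-p1`, g31; `--supports stmt-QuantumFields-24809`).  Generalises file 26 from plaquettes to arbitrary loop words: if the
link `e₀` occurs an ODD number of times in the word `w` (either orientation; hypothesis: the sign product `∏_a (−1)^[a.1 = e₀] = −1`) — e.g. every self-avoiding loop — then flipping `e₀` by the centre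
element `−1 ∈ SU(2)` changes the sign of `Re tr w` (`word_update_centre_flip`), so `⟨Re tr w⟩_(Haar^⊗E) = 0` (`integral_word_pi_eq_zero_of_odd`), and
the volume-uniform Lipschitz bound of file 21 gives ★★ `abs_word_expectation_le_of_odd`:
`|⟨Re tr w⟩_(μ_β')| ≤ 3|w|(1024π²|w|²/ρ)√108(1+12/κ)³/(1−e^(−κ/2))·|β'|` for `|β'| < 1/12`, the same constant for every `L`.
THEOREMS ONLY, no definition, no sorry; [folklore].  HONEST FRAMING: fixed cut-off, strong-coupling window, crude constant (the true behaviour of a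
large loop is the area law); nothing about `β'_K → ∞`; `UniformColdStartMixing` (24809) is NOT restated; no crux, rung or summit statement is proved;
the Yang–Mills mass gap is NOT proved.
-/

set_option autoImplicit false

noncomputable section

namespace Summit.QuantumFields.YangMills.Theorems.ColdStartUniversality.LiebRobinson

open MeasureTheory ProbabilityTheory Matrix Complex Finset Filter Set Metric Function
open scoped ComplexConjugate BigOperators Matrix NNReal ENNReal Topology
open Literature.Probability.Process Literature.MathematicalPhysics.QuantumFieldTheory
open Literature.MathematicalPhysics.QuantumFieldTheory.Balaban1983to89
open Literature.MathematicalPhysics.QuantumLattice (fundamentalRep fundamentalLatticeRep continuous_fundamentalRep fundamentalRep_apply)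

variable {L : ℕ} [NeZero L]

omit [NeZero L] in
/-- The matrix word picks up the sign `∏_a (−1)^[a.1 = e₀]` when the link `e₀` is multiplied by a central element represented by `−1`. [folklore] -/
theorem word_prod_flip (M M' : Edge 3 L → Matrix (Fin 2) (Fin 2) ℂ) (e₀ : Edge 3 L) (hM' : ∀ e, M' e = if e = e₀ then -M e else M e) :
    ∀ l : List (Edge 3 L × Bool),
      (l.map (fun a : Edge 3 L × Bool => if a.2 then (M' a.1)ᴴ else M' a.1)).prod =
        ((l.map (fun a : Edge 3 L × Bool => if a.1 = e₀ then (-1 : ℂ) else 1)).prod) •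
          (l.map (fun a : Edge 3 L × Bool => if a.2 then (M a.1)ᴴ else M a.1)).prod := by
  classical
  intro l
  induction l with
  | nil => simp
  | cons a l ih =>
    rw [List.map_cons, List.prod_cons, List.map_cons, List.prod_cons, List.map_cons, List.prod_cons, ih]
    have hfac : (if a.2 then (M' a.1)ᴴ else M' a.1) = (if a.1 = e₀ then (-1 : ℂ) else 1) • (if a.2 then (M a.1)ᴴ else M a.1) := by
      by_cases ha : a.1 = e₀
      · rw [hM', if_pos ha, if_pos ha]
        split_ifs <;> simp [Matrix.conjTranspose_neg]
      · rw [hM', if_neg ha, if_neg ha, one_smul]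
    rw [hfac, Matrix.smul_mul, Matrix.mul_smul, smul_smul]

omit [NeZero L] in
/-- ★ **One-link centre flip of a word observable**: with `V' = update V e₀ (V e₀ · c)`, `ρ(c) = −1`,
`Re tr w(coords V') = (∏_a (−1)^[a.1 = e₀])·Re tr w(coords V)`. [folklore] -/
theorem word_update_centre_flip (l : List (Edge 3 L × Bool)) (e₀ : Edge 3 L) (c : Matrix.specialUnitaryGroup (Fin 2) ℂ)
    (hc : (fundamentalRep (Fin 2) c : Matrix (Fin 2) (Fin 2) ℂ) = -1) (V : GaugeConfig 3 L (Matrix.specialUnitaryGroup (Fin 2) ℂ)) :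
    let coords : GaugeConfig 3 L (Matrix.specialUnitaryGroup (Fin 2) ℂ) → (Edge 3 L × Fin 2 × Fin 2 × Bool → ℝ) :=
      fun V q => (fun z : ℂ => if q.2.2.2 then z.im else z.re)
        ((fundamentalRep (Fin 2) (V q.1) : Matrix (Fin 2) (Fin 2) ℂ) q.2.1 q.2.2.1)
    (fun y : (Edge 3 L × Fin 2 × Fin 2 × Bool → ℝ) => ((l.map (fun a : Edge 3 L × Bool => if a.2 then ((fun (ee : Edge 3 L) => Matrix.of fun (i j : Fin 2) => ((y (ee, i, j, false) : ℝ) : ℂ) + ((y (ee, i, j, true) : ℝ) : ℂ) * Complex.I) a.1)ᴴ else (fun (ee : Edge 3 L) => Matrix.of fun (i j : Fin 2) => ((y (ee, i, j, false) : ℝ) : ℂ) + ((y (ee, i, j, true) : ℝ) : ℂ) * Complex.I) a.1)).prod).trace.re) (coords (update V e₀ (V e₀ * c))) = (l.map (fun a : Edge 3 L × Bool => if a.1 = e₀ then (-1 : ℝ) else 1)).prod * (fun y : (Edge 3 L × Fin 2 × Fin 2 × Bool → ℝ) => ((l.map (fun a : Edge 3 L × Bool => if a.2 then ((fun (ee :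 Edge 3 L) => Matrix.of fun (i j : Fin 2) => ((y (ee, i, j, false) : ℝ) : ℂ) + ((y (ee, i, j, true) : ℝ) : ℂ) * Complex.I) a.1)ᴴ else (fun (ee : Edge 3 L) => Matrix.of fun (i j : Fin 2) => ((y (ee, i, j, false) : ℝ) : ℂ) + ((y (ee, i, j, true) : ℝ) : ℂ) * Complex.I) a.1)).prod).trace.re) (coords V) := by
  intro coords
  classical
  have hM : ∀ (U : GaugeConfig 3 L (Matrix.specialUnitaryGroup (Fin 2) ℂ)) (e : Edge 3 L),
      (Matrix.of fun (a b : Fin 2) => ((coords U (e, a, b, false) : ℝ) : ℂ) + ((coords U (e, a, b, true) : ℝ) : ℂ) * Complex.I) =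
        (fundamentalRep (Fin 2) (U e) : Matrix (Fin 2) (Fin 2) ℂ) := by
    intro U e; ext a b
    simp only [Matrix.of_apply]
    exact Complex.re_add_im _
  have hM' : ∀ e : Edge 3 L, (fundamentalRep (Fin 2) (update V e₀ (V e₀ * c) e) : Matrix (Fin 2) (Fin 2) ℂ) =
      if e = e₀ then -(fundamentalRep (Fin 2) (V e) : Matrix (Fin 2) (Fin 2) ℂ) else (fundamentalRep (Fin 2) (V e) : Matrix (Fin 2) (Fin 2) ℂ) := by
    intro e
    by_cases he : e = e₀
    · subst he
      rw [if_pos rfl, update_self, map_mul, hc, mul_neg, mul_one]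
    · rw [if_neg he, update_of_ne he]
  have key := word_prod_flip (fun e => (fundamentalRep (Fin 2) (V e) : Matrix (Fin 2) (Fin 2) ℂ))
    (fun e => (fundamentalRep (Fin 2) (update V e₀ (V e₀ * c) e) : Matrix (Fin 2) (Fin 2) ℂ)) e₀ hM' l
  have hsign : ∀ l' : List (Edge 3 L × Bool), ((l'.map (fun a : Edge 3 L × Bool => if a.1 = e₀ then (-1 : ℂ) else 1)).prod) =
      (((l'.map (fun a : Edge 3 L × Bool => if a.1 = e₀ then (-1 : ℝ) else 1)).prod : ℝ) : ℂ) := by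
    intro l'
    induction l' with
    | nil => simp
    | cons a t ih =>
      simp only [List.map_cons, List.prod_cons, ih, Complex.ofReal_mul]
      split_ifs <;> simp
  simp only [hM]
  rw [key, hsign l, Matrix.trace_smul, smul_eq_mul, Complex.re_ofReal_mul]

/-- ★ **Words through the link `e₀` an odd number of times have zero mean under product Haar.** [folklore] -/
theorem integral_word_pi_eq_zero_of_odd (L : ℕ) [NeZero L] (l : List (Edge 3 L × Bool)) (e₀ : Edge 3 L) (hodd : (l.map (fun a : Edge 3 L × Bool => if a.1 = e₀ then (-1 : ℝ) else 1)).prod = -1) :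
    let coords : GaugeConfig 3 L (Matrix.specialUnitaryGroup (Fin 2) ℂ) → (Edge 3 L × Fin 2 × Fin 2 × Bool → ℝ) :=
      fun V q => (fun z : ℂ => if q.2.2.2 then z.im else z.re)
        ((fundamentalRep (Fin 2) (V q.1) : Matrix (Fin 2) (Fin 2) ℂ) q.2.1 q.2.2.1)
    ∫ V, (fun y : (Edge 3 L × Fin 2 × Fin 2 × Bool → ℝ) => ((l.map (fun a : Edge 3 L × Bool => if a.2 then ((fun (ee : Edge 3 L) => Matrix.of fun (i j : Fin 2) => ((y (ee, i, j, false) : ℝ) : ℂ) + ((y (ee, i, j, true) : ℝ) : ℂ) * Complex.I) a.1)ᴴ else (fun (ee : Edge 3 L) => Matrix.of fun (i j : Fin 2) => ((y (ee, i, j, false) : ℝ) : ℂ) + ((y (ee, i, j, true) : ℝ) : ℂ) * Complex.I) a.1)).prod).trace.re) (coords V) ∂(Measure.pi fun _ : Edge 3 L => haarProbability (Matrix.specialUnitaryGroup (Fin 2) ℂ)) = 0 := by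
  intro coords
  classical
  haveI := secondCountableTopology_su2
  haveI := borelSpace_config L
  have hmem : (-1 : Matrix (Fin 2) (Fin 2) ℂ) ∈ Matrix.specialUnitaryGroup (Fin 2) ℂ := by
    rw [Matrix.mem_specialUnitaryGroup_iff]
    refine ⟨?_, ?_⟩
    · rw [Matrix.mem_unitaryGroup_iff]; simp
    · rw [Matrix.det_neg, Matrix.det_one]; simp
  let c : Matrix.specialUnitaryGroup (Fin 2) ℂ := ⟨-1, hmem⟩
  have hρc : (fundamentalRep (Fin 2) c : Matrix (Fin 2) (Fin 2) ℂ) = -1 := rfl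
  have hmp : MeasurePreserving (fun U : GaugeConfig 3 L (Matrix.specialUnitaryGroup (Fin 2) ℂ) => update U e₀ (U e₀ * c)) (Measure.pi fun _ : Edge 3 L => haarProbability (Matrix.specialUnitaryGroup (Fin 2) ℂ)) (Measure.pi fun _ : Edge 3 L => haarProbability (Matrix.specialUnitaryGroup (Fin 2) ℂ)) :=
    Literature.MathematicalPhysics.QuantumLattice.measurePreserving_update_mul_pi (G := Matrix.specialUnitaryGroup (Fin 2) ℂ)
      e₀ (ψ := fun _ => c) measurable_const (fun _ _ => rfl)
  have hflip : ∀ V : GaugeConfig 3 L (Matrix.specialUnitaryGroup (Fin 2) ℂ),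
      (fun y : (Edge 3 L × Fin 2 × Fin 2 × Bool → ℝ) => ((l.map (fun a : Edge 3 L × Bool => if a.2 then ((fun (ee : Edge 3 L) => Matrix.of fun (i j : Fin 2) => ((y (ee, i, j, false) : ℝ) : ℂ) + ((y (ee, i, j, true) : ℝ) : ℂ) * Complex.I) a.1)ᴴ else (fun (ee : Edge 3 L) => Matrix.of fun (i j : Fin 2) => ((y (ee, i, j, false) : ℝ) : ℂ) + ((y (ee, i, j, true) : ℝ) : ℂ) * Complex.I) a.1)).prod).trace.re) (coords (update V e₀ (V e₀ * c))) = -(fun y : (Edge 3 L × Fin 2 × Fin 2 × Bool → ℝ) => ((l.map (fun a : Edge 3 L × Bool => if a.2 then ((fun (ee : Edge 3 L) => Matrix.of fun (i j : Fin 2) => ((y (ee, i, j, false) : ℝ) : ℂ) + ((y (ee, i, j, true) : ℝ) : ℂ) * Complex.I) a.1)ᴴ else (fun (ee : Edge 3 L) => Matrix.of fun (i j : Fin 2) => ((y (ee, i, j, false) : ℝ) : ℂ) + ((y (ee, i, j, true) : ℝ) : ℂ) * Complex.I) a.1)).prod).trace.re) (coords V) := by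
    intro V
    have h : (fun y : (Edge 3 L × Fin 2 × Fin 2 × Bool → ℝ) => ((l.map (fun a : Edge 3 L × Bool => if a.2 then ((fun (ee : Edge 3 L) => Matrix.of fun (i j : Fin 2) => ((y (ee, i, j, false) : ℝ) : ℂ) + ((y (ee, i, j, true) : ℝ) : ℂ) * Complex.I) a.1)ᴴ else (fun (ee : Edge 3 L) => Matrix.of fun (i j : Fin 2) => ((y (ee, i, j, false) : ℝ) : ℂ) + ((y (ee, i, j, true) : ℝ) : ℂ) * Complex.I) a.1)).prod).trace.re) (coords (update V e₀ (V e₀ * c))) = (l.map (fun a : Edge 3 L × Bool => if a.1 = e₀ then (-1 : ℝ) else 1)).prod * (fun y : (Edge 3 L × Fin 2 × Fin 2 × Bool → ℝ) => ((l.map (fun a : Edge 3 L × Bool => if a.2 then ((fun (ee : Edge 3 L) => Matrix.of fun (i j : Fin 2) => ((y (ee, i, j, false) : ℝ) : ℂ) + ((y (ee, i, j, true) : ℝ) : ℂ) * Complex.I) a.1)ᴴ else (fun (ee : Edge 3 L) => Matrix.of fun (i j : Fin 2) => ((y (ee, i, j, false) : ℝ) : ℂ) + ((y (ee, i, j, true)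 : ℝ) : ℂ) * Complex.I) a.1)).prod).trace.re) (coords V) := word_update_centre_flip l e₀ c hρc V
    rw [hodd, neg_one_mul] at h
    exact h
  have hcont : Continuous fun V : GaugeConfig 3 L (Matrix.specialUnitaryGroup (Fin 2) ℂ) => (fun y : (Edge 3 L × Fin 2 × Fin 2 × Bool → ℝ) => ((l.map (fun a : Edge 3 L × Bool => if a.2 then ((fun (ee : Edge 3 L) => Matrix.of fun (i j : Fin 2) => ((y (ee, i, j, false) : ℝ) : ℂ) + ((y (ee, i, j, true) : ℝ) : ℂ) * Complex.I) a.1)ᴴ else (fun (ee : Edge 3 L) => Matrix.of fun (i j : Fin 2) => ((y (ee, i, j, false) : ℝ) : ℂ) + ((y (ee, i, j, true) : ℝ) : ℂ) * Complex.I) a.1)).prod).trace.re) (coords V) :=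
    (contDiff_word (L := L) l (m := 1)).continuous.comp (continuous_coords (L := L))
  have hI := integral_map (μ := (Measure.pi fun _ : Edge 3 L => haarProbability (Matrix.specialUnitaryGroup (Fin 2) ℂ))) hmp.measurable.aemeasurable hcont.aestronglyMeasurable
  rw [hmp.map_eq] at hI
  have hneg : ∫ V, (fun y : (Edge 3 L × Fin 2 × Fin 2 × Bool → ℝ) => ((l.map (fun a : Edge 3 L × Bool => if a.2 then ((fun (ee : Edge 3 L) => Matrix.of fun (i j : Fin 2) => ((y (ee, i, j, false) : ℝ) : ℂ) + ((y (ee, i, j, true) : ℝ) : ℂ) * Complex.I) a.1)ᴴ else (fun (ee : Edge 3 L) => Matrix.of fun (i j : Fin 2) => ((y (ee, i, j, false) : ℝ) : ℂ) + ((y (ee, i, j, true) : ℝ) : ℂ) * Complex.I) a.1)).prod).trace.re) (coords (update V e₀ (V e₀ * c))) ∂(Measure.pi fun _ : Edge 3 L => haarProbability (Matrix.specialUnitaryGroup (Fin 2) ℂ)) = -∫ V, (fun y : (Edge 3 L × Fin 2 × Fin 2 × Bool → ℝ) => ((l.map (fun a : Edge 3 L × Bool => if a.2 then ((fun (ee :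 Edge 3 L) => Matrix.of fun (i j : Fin 2) => ((y (ee, i, j, false) : ℝ) : ℂ) + ((y (ee, i, j, true) : ℝ) : ℂ) * Complex.I) a.1)ᴴ else (fun (ee : Edge 3 L) => Matrix.of fun (i j : Fin 2) => ((y (ee, i, j, false) : ℝ) : ℂ) + ((y (ee, i, j, true) : ℝ) : ℂ) * Complex.I) a.1)).prod).trace.re) (coords V) ∂(Measure.pi fun _ : Edge 3 L => haarProbability (Matrix.specialUnitaryGroup (Fin 2) ℂ)) := by
    rw [← integral_neg]
    exact integral_congr_ae (ae_of_all _ hflip)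
  linarith [hI.trans hneg]

/-- ★★ **EVERY WILSON LOOP THROUGH SOME LINK AN ODD NUMBER OF TIMES IS `O(β')` UNIFORMLY IN THE VOLUME** (`|β'| < 1/12`; e.g. every self-avoiding
loop, for which the sign product at any of its links is `−1`): `|⟨Re tr w⟩_(μ_β')| ≤ 3|w|(1024π²|w|²/ρ)√108(1+12/κ)³/(1−e^(−κ/2))·|β'|`, the same constant
for every `L`. [folklore] -/
theorem abs_word_expectation_le_of_odd (L : ℕ) [NeZero L] (β' : ℝ) (hβ : |β'| < 1 / 12) (l : List (Edge 3 L × Bool)) (e₀ : Edge 3 L)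
    (hodd : (l.map (fun a : Edge 3 L × Bool => if a.1 = e₀ then (-1 : ℝ) else 1)).prod = -1) :
    let coords : GaugeConfig 3 L (Matrix.specialUnitaryGroup (Fin 2) ℂ) → (Edge 3 L × Fin 2 × Fin 2 × Bool → ℝ) :=
      fun V q => (fun z : ℂ => if q.2.2.2 then z.im else z.re)
        ((fundamentalRep (Fin 2) (V q.1) : Matrix (Fin 2) (Fin 2) ℂ) q.2.1 q.2.2.1)
    |∫ V, (fun y : (Edge 3 L × Fin 2 × Fin 2 × Bool → ℝ) => ((l.map (fun a : Edge 3 L × Bool => if a.2 then ((fun (ee : Edge 3 L) => Matrix.of fun (i j : Fin 2) => ((y (ee, i, j, false) : ℝ) : ℂ) + ((y (ee, i, j, true) : ℝ) : ℂ) * Complex.I) a.1)ᴴ else (fun (ee : Edge 3 L) => Matrix.of fun (i j : Fin 2) => ((y (ee, i, j, false) : ℝ) : ℂ) + ((y (ee, i, j, true) : ℝ) : ℂ) * Complex.I) a.1)).prod).trace.re) (coords V) ∂(wilsonMeasure (d := 3) (L := L) (fundamentalRep (Fin 2)) β')| ≤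
      3 * (l.length : ℝ) * ((1024 * Real.pi ^ 2 * (l.length : ℝ) ^ 2) / (1 - 12 * |β'|) * Real.exp (Real.log 108 / 2) * ((1 + 12 / ((1 - 12 * |β'|) * Real.log 108 / (2 * ((1300 + 4 * Real.sqrt 2) * |β'| + (1 - 12 * |β'|))))) ^ 3 / (1 - Real.exp (-(((1 - 12 * |β'|) * Real.log 108 / (2 * ((1300 + 4 * Real.sqrt 2) * |β'| + (1 - 12 * |β'|)))) / 2))))) * |β'| := by
  intro coords
  classical
  have hl : l ≠ [] := by
    intro h; subst h
    norm_num at hodd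
  have h0mem : (0 : ℝ) ∈ Set.Icc (-|β'|) |β'| := ⟨by simp [abs_nonneg], abs_nonneg _⟩
  have hβmem : β' ∈ Set.Icc (-|β'|) |β'| := ⟨neg_abs_le _, le_abs_self _⟩
  have hlip : |(∫ V, (fun y : (Edge 3 L × Fin 2 × Fin 2 × Bool → ℝ) => ((l.map (fun a : Edge 3 L × Bool => if a.2 then ((fun (ee : Edge 3 L) => Matrix.of fun (i j : Fin 2) => ((y (ee, i, j, false) : ℝ) : ℂ) + ((y (ee, i, j, true) : ℝ) : ℂ) * Complex.I) a.1)ᴴ else (fun (ee : Edge 3 L) => Matrix.of fun (i j : Fin 2) => ((y (ee, i, j, false) : ℝ) : ℂ) + ((y (ee, i, j, true) : ℝ) : ℂ) * Complex.I) a.1)).prod).trace.re) (coords V) ∂(wilsonMeasure (d := 3) (L := L) (fundamentalRep (Fin 2)) β')) - ∫ V, (fun y : (Edge 3 L × Fin 2 × Fin 2 × Bool → ℝ) => ((l.map (fun a : Edge 3 L × Bool => if a.2 then ((fun (ee : Edge 3 L) => Matrix.of fun (i j : Fin 2) => ((y (ee, i, j, false) : ℝ) : ℂ) + ((y (ee,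 i, j, true) : ℝ) : ℂ) * Complex.I) a.1)ᴴ else (fun (ee : Edge 3 L) => Matrix.of fun (i j : Fin 2) => ((y (ee, i, j, false) : ℝ) : ℂ) + ((y (ee, i, j, true) : ℝ) : ℂ) * Complex.I) a.1)).prod).trace.re) (coords V) ∂(wilsonMeasure (d := 3) (L := L) (fundamentalRep (Fin 2)) 0)| ≤
      3 * (l.length : ℝ) * ((1024 * Real.pi ^ 2 * (l.length : ℝ) ^ 2) / (1 - 12 * |β'|) * Real.exp (Real.log 108 / 2) * ((1 + 12 / ((1 - 12 * |β'|) * Real.log 108 / (2 * ((1300 + 4 * Real.sqrt 2) * |β'| + (1 - 12 * |β'|))))) ^ 3 / (1 - Real.exp (-(((1 - 12 * |β'|) * Real.log 108 / (2 * ((1300 + 4 * Real.sqrt 2) * |β'| + (1 - 12 * |β'|)))) / 2))))) * |β' - 0| :=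
    wilson_loop_expectation_lipschitz L β' hβ l hl h0mem hβmem
  have h0 : ∫ V, (fun y : (Edge 3 L × Fin 2 × Fin 2 × Bool → ℝ) => ((l.map (fun a : Edge 3 L × Bool => if a.2 then ((fun (ee : Edge 3 L) => Matrix.of fun (i j : Fin 2) => ((y (ee, i, j, false) : ℝ) : ℂ) + ((y (ee, i, j, true) : ℝ) : ℂ) * Complex.I) a.1)ᴴ else (fun (ee : Edge 3 L) => Matrix.of fun (i j : Fin 2) => ((y (ee, i, j, false) : ℝ) : ℂ) + ((y (ee, i, j, true) : ℝ) : ℂ) * Complex.I) a.1)).prod).trace.re) (coords V) ∂(wilsonMeasure (d := 3) (L := L) (fundamentalRep (Fin 2)) 0) = 0 := by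
    rw [wilsonMeasure_zero_eq_pi L]; exact integral_word_pi_eq_zero_of_odd L l e₀ hodd
  rw [h0, sub_zero, sub_zero] at hlip
  exact hlip

end Summit.QuantumFields.YangMills.Theorems.ColdStartUniversality.LiebRobinson
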